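import Summits.QuantumFields.YangMills.Theorems.BalabanUVNodesN08HaarCompatibilityGuardHybridIsolatedGuard
import Summits.QuantumFields.YangMills.Theorems.BalabanUVNodesN08HaarCompatibilityGuardHybridForestBlockSet
import Summits.QuantumFields.YangMills.Theorems.BalabanUVNodesN08HaarCompatibilityGuardHybridDensity

/-!
# BalabanUVNodes ∕ N08 — SECOND-ORDER DEFECT, THE TWO INGREDIENTS: (i) the isolated guard is invisible for the AXIAL averaging too — `(dU↾G_c)∘axial⁻¹ = dU(G_c) • dV`
# (part 41 at `S = ∅`); (ii) the two-guard events have mass `≤ 2·n²·h(δ)^{2(L^{d−1}−1)}`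

WIDTH SEAT `pub-ymgap-dag-n08-w3` g7, item-3 lineage PART 45A (successor of parts 38B `…GuardHybridIsolatedGuard`, 41 `…GuardHybridForestBlockSet`, 18∕36 (`dU(G_S) ≤ q^{|S|}`));
consumed by part 45B `…HaarCompatibilitySecondOrder` (E6′ to second order), 2026-08-28.  Track A, DAG node N08 = [Balaban1985UV3] Thm 1 p. 257 (compact) + Thm 2 p. 272; key item K1⁷
`StabilityBAtRecordR13SepCoPH` (stmt-QuantumFields-20542), `--supports … --as helper`.  COUNT-NEUTRAL.

THE POINT (E6′ desk + road (ii); located, count-neutral).  g0's `…HaarCompatibilityGuard` bounds the E6′ defect `|Ū_*(dU)(A) − dV(A)|` by the probability that SOME coarse bond is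
guarded, `≈ n·q`, `q = h(δ)^{L^{d−1}−1}`.  The first-order terms CANCEL: on the singleton guard set both the typed and the axial image of `dU↾G_c` are the SAME constant multiple of
`dV` — part 38B for `Ū^{{c}}`, and (§1 here) part 41's forest principle at `S = ∅` with the gauge-invariant bump `1_{G_c}` for the axial map.  §2 counts what is left: the events with
two distinct guarded bonds (`M₂`), `dU(M₂) ≤ n²q²` and `Σ_c dU(G_c ∩ M₂) ≤ n²q²` by the union bound over pairs and `dU(G_{{c,c′}}) ≤ q²`; packaged as `sum_defect_le`
(`Σ_S d_S ≤ 2n²q²`, `d_∅ = 0`, `d_{c} = dU(G_c ∩ M₂)`, `d_S = dU(E_S)` for `|S| ≥ 2`, `E_S = {guard set = S}`).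

* §1 `hybrid_empty_eq_axialAvg`, ★★ `map_restrict_guard_axialAvg_singleton`.
* §2 `measure_guard_pair_le`, `measure_twoGuards_le`, `measure_guard_inter_twoGuards_le`, `sum_ite_card_eq_one`, ★ `sum_defect_le`.

HONEST FRAMING.  [folklore] measure theory over landed modules; nothing of Bałaban's asserted; E6′ NEITHER proved NOR refuted; ONE RG step — NO (G3), NO k-uniform `hmass`; N08 NOT
discharged; counts unmoved (typed 28∕28 · discharged 5∕27); one finite 𝕋⁴ programme at fixed ε — R4 closes the CONDITIONAL rung `BalabanLadder.UV` only; the Yang–Mills mass gap (Clay)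
is NOT proved by any of this; nothing continuum ∕ ℝ⁴ ∕ OS.  0 `sorry`, 0 `def`, 0 `instance`, standard axioms.
-/

noncomputable section

open MeasureTheory
open scoped ENNReal

namespace Summit.QuantumFields.YangMills.BalabanUVNodes.N08HaarCompatibilitySecondOrderDefect

open Literature.MathematicalPhysics.QuantumFieldTheory.Balaban1983to89
open Literature.MathematicalPhysics.QuantumFieldTheory.Balaban1983to89.AveragingRT (axialAvg measurable_axialAvg map_axialAvg)
open Literature.MathematicalPhysics.QuantumFieldTheory.Balaban1983to89.BlockAveraging (Small avgFun measurable_avgFun)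
open Summit.QuantumFields.Balaban3D.Proofs
open Summit.QuantumFields.YangMills.BalabanUVNodes.N08HaarCompatibilityForests (leafOrder_single)
open Summit.QuantumFields.YangMills.BalabanUVNodes.N08HaarCompatibilityGuardCrossingJointLaw (measure_forall_small_le_pow)
open Summit.QuantumFields.YangMills.BalabanUVNodes.N08HaarCompatibilityGuardHybridPartition
  (measurable_hybrid measurableSet_guardAll measurableSet_guardEq pairwiseDisjoint_guardEq eq_sum_restrict_guardEq map_finset_sum map_avgFun_eq_sum_map_hybrid)
open Summit.QuantumFields.YangMills.BalabanUVNodes.N08HaarCompatibilityGuardHybridNearBlocks (not_canonicalFar_iff blockLocal_mul_guardAll_indicator)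
open Summit.QuantumFields.YangMills.BalabanUVNodes.N08HaarCompatibilityGuardHybridCovariance (gaugeInvariant_mul_guardAll_indicator)
open Summit.QuantumFields.YangMills.BalabanUVNodes.N08HaarCompatibilityGuardHybridIsolatedGuard (mem_blocks_singleton_iff nearIndex_eq map_restrict_guard_hybrid_singleton)
open Summit.QuantumFields.YangMills.BalabanUVNodes.N08HaarCompatibilityGuardHybridForestBlockSet (map_withDensity_guard_hybrid_eq_smul_of_blockSet_forest)

variable {P : Params} {j : ℕ} {G : Type} [GaugeGroup G] (ℰ : LoopAverage G) [DecidableEq (PBond P (j + 1))] [MeasurableSpace G] [RegularGaugeGroup G] [HaarData G]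

/-! ## §1 The isolated guard is invisible for the AXIAL averaging too -/

omit [MeasurableSpace G] [RegularGaugeGroup G] [HaarData G] in
/-- `Ū^∅ = axial` (plumbing). [folklore] -/
theorem hybrid_empty_eq_axialAvg :
    (fun (U : GaugeField P j G) (c : PBond P (j + 1)) => if c ∈ (∅ : Finset (PBond P (j + 1))) then avgFun ℰ U c else axialAvg U c) =
      (axialAvg : GaugeField P j G → GaugeField P (j + 1) G) := by
  funext U c
  rw [if_neg (Finset.notMem_empty c)]

/-- ★★ **`(dU↾G_c)∘axial⁻¹ = dU(G_c) • dV`** below the top level: the guard bump `1_{G_c}` is gauge invariant and reads only `Blk({c})`, whose near family `{c}` is a forest — part 41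
at `S = ∅`. [cite: Balaban1987RG1, (2.1) p.265 + (0.4) p.253; Balaban1985Averaging, (11) p.19 (bookkeeping — NOT in print)] -/
theorem map_restrict_guard_axialAvg_singleton (hlt : j + 1 < P.m + P.K) (hE : ∀ n, Measurable fun W : Fin (n + 1) → G => ℰ.E W) (c : PBond P (j + 1)) :
    ((fieldMeasure P j G).restrict {W : GaugeField P j G | ∀ c' ∈ ({c} : Finset (PBond P (j + 1))), Small ℰ W c'}).map
        (axialAvg : GaugeField P j G → GaugeField P (j + 1) G) =
      fieldMeasure P j G {W : GaugeField P j G | ∀ c' ∈ ({c} : Finset (PBond P (j + 1))), Small ℰ W c'} • fieldMeasure P (j + 1) G := by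
  haveI := HaarData.isProb (G := G)
  have hj : j + 1 ≤ P.m + P.K := hlt.le
  have hG := measurableSet_guardAll ℰ (P := P) (j := j) (G := G) ({c} : Finset (PBond P (j + 1)))
  -- the bump `ρ = 1 · 1_{G_c}`
  set ρ : GaugeField P j G → ℝ := fun U => (1 : ℝ) * {W : GaugeField P j G | ∀ c' ∈ ({c} : Finset (PBond P (j + 1))), Small ℰ W c'}.indicator (fun _ => (1 : ℝ)) U with hρ
  have hρm : Measurable ρ := measurable_const.mul (measurable_const.indicator hG)
  have hρ0 : ∀ W, 0 ≤ ρ W := fun W => mul_nonneg zero_le_one (Set.indicator_nonneg (fun _ _ => zero_le_one) W)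
  have hρ1 : ∀ W, ρ W ≤ 1 := fun W => by
    show (1 : ℝ) * _ ≤ 1
    rw [one_mul]
    by_cases hW : W ∈ {W : GaugeField P j G | ∀ c' ∈ ({c} : Finset (PBond P (j + 1))), Small ℰ W c'}
    · rw [Set.indicator_of_mem hW]
    · rw [Set.indicator_of_notMem hW]; exact zero_le_one
  have hρint : Integrable ρ (fieldMeasure P j G) := AveragingRT.integrable_of_abs_le hρm 1 fun W => by rw [abs_of_nonneg (hρ0 W)]; exact hρ1 W
  have hρinv : GaugeField.GaugeInvariant ρ := gaugeInvariant_mul_guardAll_indicator ℰ {c} (ρ := fun _ => (1 : ℝ)) fun _ _ => rfl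
  have hρloc := blockLocal_mul_guardAll_indicator ℰ hj ({c} : Finset (PBond P (j + 1))) (fun _ => (1 : ℝ)) fun _ _ _ => rfl
  -- the near family of `Blk({c})` is `{c}`
  have hS : ∀ c' ∈ (∅ : Finset (PBond P (j + 1))), c'.src ∈ ({c} : Finset (PBond P (j + 1))).image PBond.src ∪ ({c} : Finset (PBond P (j + 1))).image PBond.tgt ∧
      c'.tgt ∈ ({c} : Finset (PBond P (j + 1))).image PBond.src ∪ ({c} : Finset (PBond P (j + 1))).image PBond.tgt := fun c' hc' => absurd hc' (Finset.notMem_empty c')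
  have hbnear : ∀ m : Fin 1, ((fun _ : Fin 1 => c) m).src ∈ ({c} : Finset (PBond P (j + 1))).image PBond.src ∪ ({c} : Finset (PBond P (j + 1))).image PBond.tgt ∧
      ((fun _ : Fin 1 => c) m).tgt ∈ ({c} : Finset (PBond P (j + 1))).image PBond.src ∪ ({c} : Finset (PBond P (j + 1))).image PBond.tgt :=
    fun _ => ⟨(mem_blocks_singleton_iff c _).2 (Or.inl rfl), (mem_blocks_singleton_iff c _).2 (Or.inr rfl)⟩
  have hbonto : ∀ c' : PBond P (j + 1), c'.src ∈ ({c} : Finset (PBond P (j + 1))).image PBond.src ∪ ({c} : Finset (PBond P (j + 1))).image PBond.tgt ∧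
      c'.tgt ∈ ({c} : Finset (PBond P (j + 1))).image PBond.src ∪ ({c} : Finset (PBond P (j + 1))).image PBond.tgt → ∃ m : Fin 1, (fun _ : Fin 1 => c) m = c' :=
    fun c' hc' => ⟨0, (nearIndex_eq hlt c ((not_canonicalFar_iff _ c').2 hc')).symm⟩
  have h := map_withDensity_guard_hybrid_eq_smul_of_blockSet_forest ℰ hj hE (∅ : Finset (PBond P (j + 1))) _ hS (fun _ : Fin 1 => c)
    (fun _ _ _ => Subsingleton.elim _ _) hbnear hbonto (fun _ => false) (leafOrder_single c false) ρ hρm hρ0 hρint hρinv hρloc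
  -- unfold: the guard set of `∅` is everything, `Ū^∅ = axial`, `ρ·1 = 1_{G_c}`
  have huniv : {W : GaugeField P j G | ∀ c' ∈ (∅ : Finset (PBond P (j + 1))), Small ℰ W c'} = Set.univ :=
    Set.eq_univ_of_forall fun W c' hc' => absurd hc' (Finset.notMem_empty c')
  have hfun : (fun U : GaugeField P j G => ENNReal.ofReal (ρ U * {W : GaugeField P j G | ∀ c' ∈ (∅ : Finset (PBond P (j + 1))), Small ℰ W c'}.indicator (fun _ => (1 : ℝ)) U)) =
      {W : GaugeField P j G | ∀ c' ∈ ({c} : Finset (PBond P (j + 1))), Small ℰ W c'}.indicator (1 : GaugeField P j G → ℝ≥0∞) := by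
    funext U
    rw [huniv, Set.indicator_univ, mul_one]
    show ENNReal.ofReal ((1 : ℝ) * _) = _
    rw [one_mul]
    by_cases hU : U ∈ {W : GaugeField P j G | ∀ c' ∈ ({c} : Finset (PBond P (j + 1))), Small ℰ W c'}
    · rw [Set.indicator_of_mem hU, Set.indicator_of_mem hU, ENNReal.ofReal_one, Pi.one_apply]
    · rw [Set.indicator_of_notMem hU, Set.indicator_of_notMem hU, ENNReal.ofReal_zero]
  have hint : (fun U : GaugeField P j G => ρ U * {W : GaugeField P j G | ∀ c' ∈ (∅ : Finset (PBond P (j + 1))), Small ℰ W c'}.indicator (fun _ => (1 : ℝ)) U) =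
      {W : GaugeField P j G | ∀ c' ∈ ({c} : Finset (PBond P (j + 1))), Small ℰ W c'}.indicator (fun _ => (1 : ℝ)) := by
    funext U
    rw [huniv, Set.indicator_univ, mul_one]
    show (1 : ℝ) * _ = _
    rw [one_mul]
  rw [hfun, withDensity_indicator_one hG, hybrid_empty_eq_axialAvg, hint, integral_indicator hG, setIntegral_const, smul_eq_mul, mul_one, measureReal_def,
    ENNReal.ofReal_toReal (measure_ne_top _ _)] at h
  exact h

/-! ## §2 Counting: the second-order events -/

/-- `dU(G_{{c,c′}}) ≤ q²` for `c ≠ c′` (part 18 ∕ 36). [cite: Balaban1987RG1, (0.4) p.253 (bookkeeping)] -/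
theorem measure_guard_pair_le (hj : j + 1 ≤ P.m + P.K) {c c' : PBond P (j + 1)} (hcc' : c ≠ c') :
    fieldMeasure P j G {W : GaugeField P j G | ∀ c'' ∈ ({c, c'} : Finset (PBond P (j + 1))), Small ℰ W c''} ≤
      (HaarData.haar : Measure G) {g : G | dist1 g < ℰ.δ} ^ (2 * (P.L ^ (P.d - 1) - 1)) := by
  have h := measure_forall_small_le_pow ℰ hj ({c, c'} : Finset (PBond P (j + 1)))
  rwa [Finset.card_pair hcc'] at h

/-- **The two-guard event** `M₂ = {two distinct guarded bonds}` has `dU(M₂) ≤ n²·q²`. [cite: Balaban1987RG1, (0.4) p.253 (bookkeeping)] -/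
theorem measure_twoGuards_le (hj : j + 1 ≤ P.m + P.K) :
    fieldMeasure P j G {W : GaugeField P j G | ∃ c c' : PBond P (j + 1), c ≠ c' ∧ Small ℰ W c ∧ Small ℰ W c'} ≤
      (Fintype.card (PBond P (j + 1)) : ℝ≥0∞) ^ 2 * (HaarData.haar : Measure G) {g : G | dist1 g < ℰ.δ} ^ (2 * (P.L ^ (P.d - 1) - 1)) := by
  classical
  have hsub : {W : GaugeField P j G | ∃ c c' : PBond P (j + 1), c ≠ c' ∧ Small ℰ W c ∧ Small ℰ W c'} ⊆
      ⋃ c ∈ (Finset.univ : Finset (PBond P (j + 1))), ⋃ c' ∈ Finset.univ.erase c, {W : GaugeField P j G | ∀ c'' ∈ ({c, c'} : Finset (PBond P (j + 1))), Small ℰ W c''} := by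
    intro W hW
    obtain ⟨c, c', hcc', hc, hc'⟩ := hW
    simp only [Set.mem_iUnion, Finset.mem_univ, Finset.mem_erase, exists_prop, true_and, and_true, Set.mem_setOf_eq]
    exact ⟨c, c', hcc'.symm, fun c'' hc'' => by
      rcases Finset.mem_insert.1 hc'' with h | h
      · rw [h]; exact hc
      · rw [Finset.mem_singleton.1 h]; exact hc'⟩
  refine (measure_mono hsub).trans ((measure_biUnion_finset_le _ _).trans ?_)
  have hinner : ∀ c : PBond P (j + 1), fieldMeasure P j G (⋃ c' ∈ Finset.univ.erase c, {W : GaugeField P j G | ∀ c'' ∈ ({c, c'} : Finset (PBond P (j + 1))), Small ℰ W c''}) ≤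
      (Fintype.card (PBond P (j + 1)) : ℝ≥0∞) * (HaarData.haar : Measure G) {g : G | dist1 g < ℰ.δ} ^ (2 * (P.L ^ (P.d - 1) - 1)) := by
    intro c
    refine (measure_biUnion_finset_le _ _).trans ?_
    refine (Finset.sum_le_sum fun c' hc' => measure_guard_pair_le ℰ hj (Finset.ne_of_mem_erase hc').symm).trans ?_
    rw [Finset.sum_const, nsmul_eq_mul]
    exact mul_le_mul' (by exact_mod_cast (Finset.card_erase_le).trans (Finset.card_univ (α := PBond P (j + 1))).le) le_rfl
  refine (Finset.sum_le_sum fun c _ => hinner c).trans ?_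
  rw [Finset.sum_const, nsmul_eq_mul, Finset.card_univ, ← mul_assoc, sq]

/-- `dU(G_c ∩ M₂) ≤ n·q²`: a guarded `c` with a second guarded bond lies in some `G_{{c,c′}}`, `c′ ≠ c`. [cite: Balaban1987RG1, (0.4) p.253 (bookkeeping)] -/
theorem measure_guard_inter_twoGuards_le (hj : j + 1 ≤ P.m + P.K) (c : PBond P (j + 1)) :
    fieldMeasure P j G ({W : GaugeField P j G | ∀ c' ∈ ({c} : Finset (PBond P (j + 1))), Small ℰ W c'} ∩
        {W : GaugeField P j G | ∃ c₁ c₂ : PBond P (j + 1), c₁ ≠ c₂ ∧ Small ℰ W c₁ ∧ Small ℰ W c₂}) ≤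
      (Fintype.card (PBond P (j + 1)) : ℝ≥0∞) * (HaarData.haar : Measure G) {g : G | dist1 g < ℰ.δ} ^ (2 * (P.L ^ (P.d - 1) - 1)) := by
  classical
  have hsub : {W : GaugeField P j G | ∀ c' ∈ ({c} : Finset (PBond P (j + 1))), Small ℰ W c'} ∩
      {W : GaugeField P j G | ∃ c₁ c₂ : PBond P (j + 1), c₁ ≠ c₂ ∧ Small ℰ W c₁ ∧ Small ℰ W c₂} ⊆
        ⋃ c' ∈ Finset.univ.erase c, {W : GaugeField P j G | ∀ c'' ∈ ({c, c'} : Finset (PBond P (j + 1))), Small ℰ W c''} := by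
    rintro W ⟨hWc, c₁, c₂, h12, h1, h2⟩
    have hc : Small ℰ W c := hWc c (Finset.mem_singleton_self c)
    -- one of `c₁, c₂` differs from `c`
    obtain ⟨c', hc'ne, hc'⟩ : ∃ c', c' ≠ c ∧ Small ℰ W c' := by
      by_cases h1c : c₁ = c
      · exact ⟨c₂, fun h => h12 (h1c.trans h.symm), h2⟩
      · exact ⟨c₁, h1c, h1⟩
    simp only [Set.mem_iUnion, Finset.mem_erase, Finset.mem_univ, and_true, exists_prop, Set.mem_setOf_eq]
    exact ⟨c', hc'ne, fun c'' hc'' => by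
      rcases Finset.mem_insert.1 hc'' with h | h
      · rw [h]; exact hc
      · rw [Finset.mem_singleton.1 h]; exact hc'⟩
  refine (measure_mono hsub).trans ((measure_biUnion_finset_le _ _).trans ?_)
  refine (Finset.sum_le_sum fun c' hc' => measure_guard_pair_le ℰ hj (Finset.ne_of_mem_erase hc').symm).trans ?_
  rw [Finset.sum_const, nsmul_eq_mul]
  exact mul_le_mul' (by exact_mod_cast (Finset.card_erase_le).trans (Finset.card_univ (α := PBond P (j + 1))).le) le_rfl

/-- Reindexing the singletons: `Σ_S [|S| = 1] f S = Σ_c f {c}` (plumbing). [folklore] -/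
theorem sum_ite_card_eq_one {M : Type*} [AddCommMonoid M] (f : Finset (PBond P (j + 1)) → M) :
    ∑ S : Finset (PBond P (j + 1)), (if S.card = 1 then f S else 0) = ∑ c : PBond P (j + 1), f {c} := by
  classical
  rw [← Finset.sum_filter]
  have hset : (Finset.univ : Finset (Finset (PBond P (j + 1)))).filter (fun S => S.card = 1) =
      (Finset.univ : Finset (PBond P (j + 1))).map ⟨fun c => ({c} : Finset (PBond P (j + 1))), Finset.singleton_injective⟩ := by
    ext S
    simp only [Finset.mem_filter, Finset.mem_univ, true_and, Finset.mem_map, Function.Embedding.coeFn_mk, Finset.card_eq_one]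
    exact ⟨fun ⟨a, ha⟩ => ⟨a, ha.symm⟩, fun ⟨a, ha⟩ => ⟨a, ha.symm⟩⟩
  rw [hset, Finset.sum_map]
  rfl

/-- **The second-order error** `ε := Σ_S d_S`, `d_∅ = 0`, `d_{c} = dU(G_c ∩ M₂)`, `d_S = dU(E_S)` (`|S| ≥ 2`), is `≤ 2·n²·q²`. [cite: Balaban1987RG1, (0.4) p.253 (bookkeeping)] -/
theorem sum_defect_le (hj : j + 1 ≤ P.m + P.K) :
    ∑ S : Finset (PBond P (j + 1)),
        (if S = ∅ then (0 : ℝ≥0∞) else if S.card = 1 then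
          fieldMeasure P j G ({W : GaugeField P j G | ∀ c' ∈ S, Small ℰ W c'} ∩ {W : GaugeField P j G | ∃ c₁ c₂ : PBond P (j + 1), c₁ ≠ c₂ ∧ Small ℰ W c₁ ∧ Small ℰ W c₂})
        else fieldMeasure P j G {W : GaugeField P j G | ∀ c', Small ℰ W c' ↔ c' ∈ S}) ≤
      2 * (Fintype.card (PBond P (j + 1)) : ℝ≥0∞) ^ 2 * (HaarData.haar : Measure G) {g : G | dist1 g < ℰ.δ} ^ (2 * (P.L ^ (P.d - 1) - 1)) := by
  classical
  -- split the summand into the singleton part and the `|S| ≥ 2` part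
  have hsplit : ∀ S : Finset (PBond P (j + 1)),
      (if S = ∅ then (0 : ℝ≥0∞) else if S.card = 1 then
          fieldMeasure P j G ({W : GaugeField P j G | ∀ c' ∈ S, Small ℰ W c'} ∩ {W : GaugeField P j G | ∃ c₁ c₂ : PBond P (j + 1), c₁ ≠ c₂ ∧ Small ℰ W c₁ ∧ Small ℰ W c₂})
        else fieldMeasure P j G {W : GaugeField P j G | ∀ c', Small ℰ W c' ↔ c' ∈ S}) =
      (if S.card = 1 then fieldMeasure P j G ({W : GaugeField P j G | ∀ c' ∈ S, Small ℰ W c'} ∩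
          {W : GaugeField P j G | ∃ c₁ c₂ : PBond P (j + 1), c₁ ≠ c₂ ∧ Small ℰ W c₁ ∧ Small ℰ W c₂}) else 0) +
        (if 2 ≤ S.card then fieldMeasure P j G {W : GaugeField P j G | ∀ c', Small ℰ W c' ↔ c' ∈ S} else 0) := by
    intro S
    by_cases h0 : S = ∅
    · simp [h0]
    · by_cases h1 : S.card = 1
      · have h2 : ¬ 2 ≤ S.card := by omega
        rw [if_neg h0, if_pos h1, if_pos h1, if_neg h2, add_zero]
      · have hpos : 0 < S.card := Finset.card_pos.2 (Finset.nonempty_iff_ne_empty.2 h0)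
        have h2 : 2 ≤ S.card := by omega
        rw [if_neg h0, if_neg h1, if_neg h1, if_pos h2, zero_add]
  simp_rw [hsplit]
  rw [Finset.sum_add_distrib, two_mul, add_mul]
  refine add_le_add ?_ ?_
  · -- singletons
    rw [sum_ite_card_eq_one (fun S => fieldMeasure P j G ({W : GaugeField P j G | ∀ c' ∈ S, Small ℰ W c'} ∩
      {W : GaugeField P j G | ∃ c₁ c₂ : PBond P (j + 1), c₁ ≠ c₂ ∧ Small ℰ W c₁ ∧ Small ℰ W c₂}))]
    refine (Finset.sum_le_sum fun c _ => measure_guard_inter_twoGuards_le ℰ hj c).trans ?_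
    rw [Finset.sum_const, nsmul_eq_mul, Finset.card_univ, ← mul_assoc, sq]
  · -- `|S| ≥ 2`: a disjoint union inside `M₂`
    rw [← Finset.sum_filter]
    have hdisj : ((Finset.univ : Finset (Finset (PBond P (j + 1)))).filter (fun S => 2 ≤ S.card) : Set (Finset (PBond P (j + 1)))).PairwiseDisjoint
        fun S => {W : GaugeField P j G | ∀ c', Small ℰ W c' ↔ c' ∈ S} :=
      (pairwiseDisjoint_guardEq ℰ (P := P) (j := j) (G := G)).subset (Set.subset_univ _)
    rw [← measure_biUnion_finset hdisj fun S _ => measurableSet_guardEq ℰ S]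
    refine (measure_mono ?_).trans (measure_twoGuards_le ℰ hj)
    intro W hW
    simp only [Set.mem_iUnion, Finset.mem_filter, Finset.mem_univ, true_and, exists_prop, Set.mem_setOf_eq] at hW
    obtain ⟨S, hS2, hWS⟩ := hW
    obtain ⟨a, b, ha, hb, hab⟩ := Finset.one_lt_card_iff.1 (by omega : 1 < S.card)
    exact ⟨a, b, hab, (hWS a).2 ha, (hWS b).2 hb⟩

end Summit.QuantumFields.YangMills.BalabanUVNodes.N08HaarCompatibilitySecondOrderDefect

end
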